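import Summits.BirchSwinnertonDyer.BirchSwinnertonDyer.Theses.EisensteinPrimes
import Summits.BirchSwinnertonDyer.BirchSwinnertonDyer.Theorems.Rank1ResidualX1Isogeny
import Summits.BirchSwinnertonDyer.Rank1Residual.X1.TamagawaSqueeze
import Literature.NumberTheory.EllipticCurves.Rank1Residual.ClassX1Isogeny
import HarnessLib

/-!
# Crux idea g14 — PENCIL EXCHANGE (tangent-pencil exchange trick) on crux 5 of route
`EisensteinPrimes` (`stmt-BirchSwinnertonDyer-19035`, decl
`Summit.BirchSwinnertonDyer.BirchSwinnertonDyer.Theses.EisensteinPrimes.MazurMCOnX1RankZero`)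

STRATUM. The whole content of the crux: type-A anomalous good Eisenstein isogeny classes of analytic
rank `0` (`ClassX1 W p`, `r_an = 0`). Work at the ÉTALE END `E_ét` of the class: `E_ét[p]` is the
non-split extension `0 → μ_p → E_ét[p] → ℤ/p → 0`, recorded by its Kummer class
`c_E ∈ V_Σ := H¹_Σ(ℚ, 𝔽_p(ω⁻¹))` (an `𝔽_p`-vector space of dimension `#Σ` (+1); at `p = 3`,
`c_E = [d]`, `d` the squarefree Kummer radicand, `V` = exponent vectors mod 3).

THE LEVER (new on this problem): treat BOTH sides of the main conjecture as `𝔽_p`-LINEAR maps on the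
residual Selmer space `V_Σ` and run an EXCHANGE ARGUMENT along pencils `c + x·c₁`:
* `Ξ : V_Σ →ₗ 𝔽_p⟦T⟧` — the ANALYTIC tangent functional: `Ξ(c_g) =` the `Σ`-depleted `p`-adic
  `L`-function of ANY weight-2 Eisenstein newform `g` with residual extension class `c_g`, in the
  étale-lattice period, mod `𝔭` (K1 = the bsd-eis cell's numerical law (C-Θ): lam-a MEMO-6, `p = 3`:
  8 397/8 397 collinear class triples, rank 284 on 285 primes; `p = 5`: full `P¹(𝔽₅)` pencils);
  `ord_T Ξ(c_g) = λ_an^Σ(g)`, `Ξ(c_g) ≠ 0 ⟺ μ_an(g_ét) = 0`.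
* `r : V_Σ →ₗ 𝔽_p⟦T⟧` — the ALGEBRAIC tangent functional: the reduction of a characteristic series
  of the `Σ`-imprimitive dual Selmer group of the residual deformation at `c` (Trifković's Gram power
  series is already bilinear in the Kummer generators), `ord_T r(c) (+ s_Σ) = λ_alg^Σ(c)` when
  `r(c) ≠ 0 ⟺ μ_alg(T_c^{ét}) = 0` (K2).
* ONE-SIDED Kato (Kato 2004 Thm. 17.4 ⊗ ℚ_p; Wuthrich 2014 integrally for curves): at every MODULAR
  class `λ_alg ≤ λ_an` and `μ_an = 0 ⇒ μ_alg = 0` — `KatoAlong`, `KatoMuAlong` below.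
* HELPERS (K3): for a modular class `c` and an order `m` below the analytic order of `c` there is a
  modular class `c₁` with `ord Ξ(c₁) = m` whose punctured pencil `c + x·c₁ (x ≠ 0)` consists of
  modular classes (realizability of residual extensions by Eisenstein newforms: Mazur, Ribet–Yoo,
  Wake–Wang-Erickson; abundance of normalized orders: lam-a's class table) — `HelperSupply`.
EXCHANGE: if `ord r(c) = m < ord Ξ(c)`, take the helper `c₁`; by induction on `m`, `ord r(c₁) = m`;
with `x* := −lc(r c)/lc(r c₁) ≠ 0` the class `c' = c + x*·c₁` is modular, `ord Ξ(c') = m` but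
`ord r(c') > m` — `λ_alg(c') > λ_an(c')`, contradicting Kato AT `c'`. Hence `ord r(c) = ord Ξ(c)` at
every modular class (`hasOrd_alg_of_hasOrd_an`, PROVED below, no sorry), and `r(c) ≠ 0 ⇒ Ξ(c) ≠ 0`
(`an_ne_zero_of_alg_ne_zero`: `μ_alg(E_ét) = 0 ⇒ μ_an(E_ét) = 0`, PROVED). No seed main conjecture,
no reciprocity law `r ≐ Ξ`, no Euler system beyond Kato's: the inequality at the NEIGHBOURS forces
the equality at `c`. Base case `ord Ξ = 0` is Kato alone.

TYPED HERE (0 sorry, 0 new axioms): the pure exchange lemma over any field (§1); the TANGENT PACKAGE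
at an X1 rank-0 pair — the frame `(V, M, Ξ, r)` with Kato + helpers, the class `cl` of the étale end
`Wet ∼ W`, K4 `r cl ≠ 0` (`μ_alg(E_ét) = 0`, the residual shared with idea trifkovic-gram-series /
line mudescent stub 3′), and the two DICTIONARIES in the tree's crux-5 currency
(`X1.MuPart.AnalyticMuLE Wet p 0`, `X1.ParitySqueeze.AnalyticLambdaEq Wet p (n + G)`,
`X1.TamagawaSqueeze.AlgebraicLambdaGE Wet p (n + G)`; `G` = the class-independent Euler-factor
shift of `Σ`-depletion) (§2); and the door `mazurMCOnX1RankZero_of_tangentPackages` : packages at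
every X1 rank-0 pair + the PUBLISHED inputs of the tree's isogeny door ⟹ the crux BY NAME (§3).
What is NOT typed (the cruxes of the idea, informal in the card): K1 (existence + linearity of `Ξ`
with the étale periods = (C-Θ) as a theorem), K2 (linearity/valuativity of `r`), K3 (helper supply).

References: Kato 2004 Thm. 17.4; Wuthrich 2014 Thm. 16; Greenberg–Vatsal 2000 §1 (9)–(10), Thm. 1.3;
Greenberg LNM 1716 Cor. 5.6; Trifković 2005 (CJM 57) Thm. 1.1; Pollack–Wake 2025 (Tunis. J. Math. 7)
Thm. 1.1–1.2; Bellaïche–Pollack 2019 Thm. 1.2; Wake–Wang-Erickson 2021 (squarefree Eisenstein ideal)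
Thm. 1.5.1/1.5.5; Hirano 2018 (BSMF 146) Thm. 0.2; HOME/lam-a-g6/lam-a-MEMO-6.md §1–§5.
-/

set_option linter.dupNamespace false
set_option autoImplicit false

noncomputable section

open scoped Classical

namespace Summit.BirchSwinnertonDyer.BirchSwinnertonDyer.Cruxes.MazurMCOnX1RankZero.PencilExchange

/-! ## §1. The pure exchange lemma (linear algebra over a field; PROVED) -/

section Pure

variable {k : Type*} [Field k] {V : Type*} [AddCommGroup V] [Module k V]

/-- `HasOrd f n`: the power series `f` has `T`-order exactly `n` (coefficients below `n` vanish, the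
`n`-th does not). Self-contained (avoids `PowerSeries.order : ℕ∞`). -/
def HasOrd (f : PowerSeries k) (n : ℕ) : Prop :=
  (∀ i, i < n → PowerSeries.coeff i f = 0) ∧ PowerSeries.coeff n f ≠ 0

lemma ne_zero_of_hasOrd {f : PowerSeries k} {n : ℕ} (h : HasOrd f n) : f ≠ 0 := by
  rintro rfl
  exact h.2 (by simp)

lemma exists_hasOrd_of_ne_zero {f : PowerSeries k} (hf : f ≠ 0) : ∃ n, HasOrd f n := by
  have hex : ∃ n, PowerSeries.coeff n f ≠ 0 := by
    by_contra hall
    push Not at hall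
    exact hf (PowerSeries.ext (fun n => by rw [hall n, map_zero]))
  refine ⟨Nat.find hex, fun i hi => ?_, Nat.find_spec hex⟩
  by_contra hne
  exact Nat.find_min hex hi hne

/-- One-sided Kato along the modular set `M`: `λ_alg ≤ λ_an` (orders of `r` vs `Ξ`). -/
def KatoAlong (M : Set V) (Ξ r : V →ₗ[k] PowerSeries k) : Prop :=
  ∀ c ∈ M, ∀ m n : ℕ, HasOrd (Ξ c) n → HasOrd (r c) m → m ≤ n

/-- Integral Kato along `M`, μ-part: `μ_an = 0 ⇒ μ_alg = 0` (`Ξ c ≠ 0 ⇒ r c ≠ 0`). -/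
def KatoMuAlong (M : Set V) (Ξ r : V →ₗ[k] PowerSeries k) : Prop :=
  ∀ c ∈ M, Ξ c ≠ 0 → r c ≠ 0

/-- Helper supply: at a modular class `c` whose algebraic order is `m` while `Ξ c` vanishes through
degree `m`, there is a modular helper `c₁` of analytic order exactly `m` whose punctured pencil through
`c` stays modular. -/
def HelperSupply (M : Set V) (Ξ r : V →ₗ[k] PowerSeries k) : Prop :=
  ∀ c ∈ M, ∀ m : ℕ, HasOrd (r c) m → (∀ i, i ≤ m → PowerSeries.coeff i (Ξ c) = 0) →
    ∃ c₁ ∈ M, HasOrd (Ξ c₁) m ∧ ∀ x : k, x ≠ 0 → c + x • c₁ ∈ M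

/-- **The exchange step.** A modular `c` with `ord r(c) = m`, `Ξ(c) ≡ 0 (mod T^{m+1})`, and a helper
`c₁` with `ord Ξ(c₁) = ord r(c₁) = m` and modular punctured pencil contradict one-sided Kato: at
`x* = −lc(r c)/lc(r c₁)` the class `c + x*·c₁` has analytic order `m` and algebraic order `> m`. -/
theorem exchange_step {M : Set V} {Ξ r : V →ₗ[k] PowerSeries k} (hK : KatoAlong M Ξ r)
    (hμ : KatoMuAlong M Ξ r) {c c₁ : V} {m : ℕ} (hm : HasOrd (r c) m)
    (hΞlow : ∀ i, i ≤ m → PowerSeries.coeff i (Ξ c) = 0) (hΞ₁ : HasOrd (Ξ c₁) m)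
    (hr₁ : HasOrd (r c₁) m) (hpen : ∀ x : k, x ≠ 0 → c + x • c₁ ∈ M) : False := by
  have ha0 : PowerSeries.coeff m (r c) ≠ 0 := hm.2
  have hb0 : PowerSeries.coeff m (r c₁) ≠ 0 := hr₁.2
  set x : k := -(PowerSeries.coeff m (r c) * (PowerSeries.coeff m (r c₁))⁻¹) with hx
  have hx0 : x ≠ 0 := by
    rw [hx, neg_ne_zero]
    exact mul_ne_zero ha0 (inv_ne_zero hb0)
  have hc' : c + x • c₁ ∈ M := hpen x hx0
  -- analytic order of the exchanged class is `m`
  have hΞ' : HasOrd (Ξ (c + x • c₁)) m := by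
    refine ⟨fun i hi => ?_, ?_⟩
    · rw [map_add, map_smul, map_add, map_smul, smul_eq_mul, hΞlow i hi.le, hΞ₁.1 i hi,
        mul_zero, add_zero]
    · rw [map_add, map_smul, map_add, map_smul, smul_eq_mul, hΞlow m le_rfl, zero_add]
      exact mul_ne_zero hx0 hΞ₁.2
  -- algebraic side: all coefficients through degree `m` vanish
  have hrlow : ∀ i, i ≤ m → PowerSeries.coeff i (r (c + x • c₁)) = 0 := by
    intro i hi
    rw [map_add, map_smul, map_add, map_smul, smul_eq_mul]
    rcases hi.lt_or_eq with hlt | rfl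
    · rw [hm.1 i hlt, hr₁.1 i hlt, mul_zero, add_zero]
    · rw [hx, neg_mul, inv_mul_cancel_right₀ hb0, add_neg_cancel]
  have hr'0 : r (c + x • c₁) ≠ 0 := hμ _ hc' (ne_zero_of_hasOrd hΞ')
  obtain ⟨m', hm'⟩ := exists_hasOrd_of_ne_zero hr'0
  exact hm'.2 (hrlow m' (hK _ hc' m' m hΞ' hm'))

/-- **Pencil exchange, λ-form: one-sided Kato + helpers ⟹ equality of orders at every modular
class** (`λ_alg = λ_an`), by strong induction on the analytic order. -/
theorem hasOrd_alg_of_hasOrd_an {M : Set V} {Ξ r : V →ₗ[k] PowerSeries k} (hK : KatoAlong M Ξ r)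
    (hμ : KatoMuAlong M Ξ r) (hH : HelperSupply M Ξ r) :
    ∀ n : ℕ, ∀ c ∈ M, HasOrd (Ξ c) n → HasOrd (r c) n := by
  intro n
  induction n using Nat.strong_induction_on with
  | _ n ih =>
    intro c hc hΞ
    obtain ⟨m, hm⟩ := exists_hasOrd_of_ne_zero (hμ c hc (ne_zero_of_hasOrd hΞ))
    rcases (hK c hc m n hΞ hm).eq_or_lt with rfl | hlt
    · exact hm
    · exfalso
      have hΞlow : ∀ i, i ≤ m → PowerSeries.coeff i (Ξ c) = 0 :=
        fun i hi => hΞ.1 i (lt_of_le_of_lt hi hlt)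
      obtain ⟨c₁, hc₁, hΞ₁, hpen⟩ := hH c hc m hm hΞlow
      exact exchange_step hK hμ hm hΞlow hΞ₁ (ih m hlt c₁ hc₁ hΞ₁) hpen

/-- **Pencil exchange, μ-form: `μ_alg = 0 ⟹ μ_an = 0` at a modular class** (`r c ≠ 0 ⇒ Ξ c ≠ 0`). -/
theorem an_ne_zero_of_alg_ne_zero {M : Set V} {Ξ r : V →ₗ[k] PowerSeries k} (hK : KatoAlong M Ξ r)
    (hμ : KatoMuAlong M Ξ r) (hH : HelperSupply M Ξ r) :
    ∀ c ∈ M, r c ≠ 0 → Ξ c ≠ 0 := by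
  intro c hc hr hΞ0
  obtain ⟨m, hm⟩ := exists_hasOrd_of_ne_zero hr
  have hΞlow : ∀ i, i ≤ m → PowerSeries.coeff i (Ξ c) = 0 := fun i _ => by
    rw [hΞ0, map_zero]
  obtain ⟨c₁, hc₁, hΞ₁, hpen⟩ := hH c hc m hm hΞlow
  exact exchange_step hK hμ hm hΞlow hΞ₁ (hasOrd_alg_of_hasOrd_an hK hμ hH m c₁ hc₁ hΞ₁) hpen

end Pure

/-! ## §2. The tangent package at an X1 rank-0 pair (the idea's cruxes K1–K4 as typed sockets) -/

open WeierstrassCurve Literature.NumberTheory.EllipticCurves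
  Literature.NumberTheory.EllipticCurves.ModularForms
  Literature.NumberTheory.EllipticCurves.Rank1Residual
  Summit.BirchSwinnertonDyer.BirchSwinnertonDyer.Theorems.Rank1ResidualX1Defs

/-- **TANGENT PACKAGE at `(W, p)`.** A residual Selmer frame `(V, M, Ξ, r)` over `𝔽_p` with
one-sided Kato along the modular set and helper supply (K1 ∧ K2 ∧ K3 ∧ Kato), the class `cl ∈ M` of
the étale end `Wet ∼ W` with `r cl ≠ 0` (K4: `μ_alg(E_ét) = 0`), and the two DICTIONARIES reading the
orders of `Ξ cl` / `r cl` as the tree's analytic / algebraic λ-statements at `Wet` (shift `G`). -/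
structure TangentPackage (W : WeierstrassCurve ℚ) [W.IsElliptic] [W.IsGloballyMinimal] (p : ℕ)
    [Fact p.Prime] where
  /-- the residual Selmer space `V_Σ = H¹_Σ(ℚ, 𝔽_p(ω⁻¹))` -/
  V : Type
  [instAddCommGroup : AddCommGroup V]
  [instModule : Module (ZMod p) V]
  /-- the modular (realized-by-Eisenstein-newforms) classes -/
  M : Set V
  /-- K1: the analytic tangent functional (class ↦ depleted `p`-adic `L`-function mod `𝔭`) -/
  Ξ : V →ₗ[ZMod p] PowerSeries (ZMod p)
  /-- K2: the algebraic tangent functional (class ↦ reduced characteristic series) -/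
  r : V →ₗ[ZMod p] PowerSeries (ZMod p)
  kato : KatoAlong M Ξ r
  katoMu : KatoMuAlong M Ξ r
  /-- K3 -/
  helpers : HelperSupply M Ξ r
  /-- the étale end of the isogeny class of `W` -/
  Wet : WeierstrassCurve ℚ
  [instEll : Wet.IsElliptic]
  [instMin : Wet.IsGloballyMinimal]
  iso : IsIsogenous W Wet
  /-- its residual extension class -/
  cl : V
  cl_mem : cl ∈ M
  /-- K4: `μ_alg(E_ét) = 0` -/
  alg_ne_zero : r cl ≠ 0
  /-- the class-independent Euler-factor shift of `Σ`-depletion -/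
  G : ℕ
  /-- K1 dictionary: `Ξ cl ≠ 0` is `μ_an(E_ét) = 0`; `ord Ξ cl = n` is `λ_an(E_ét) = n + G` -/
  an_mu : Ξ cl ≠ 0 → Summit.BirchSwinnertonDyer.Rank1Residual.X1.MuPart.AnalyticMuLE Wet p 0
  an_lam : ∀ n : ℕ, HasOrd (Ξ cl) n →
    Summit.BirchSwinnertonDyer.Rank1Residual.X1.ParitySqueeze.AnalyticLambdaEq Wet p (n + G)
  /-- K2 dictionary (inequality direction only): `ord r cl = n` gives `λ_alg(E_ét) ≥ n + G` -/
  alg_lam : ∀ n : ℕ, HasOrd (r cl) n →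
    Summit.BirchSwinnertonDyer.Rank1Residual.X1.TamagawaSqueeze.AlgebraicLambdaGE Wet p (n + G)

attribute [instance] TangentPackage.instAddCommGroup TangentPackage.instModule
  TangentPackage.instEll TangentPackage.instMin

/-- **The package decides Mazur's main conjecture at the étale end** (Wuthrich Thm. 16 as the named
PUBLISHED input `hW16`; the exchange lemma supplies `μ_an(E_ét) = 0` and `λ_alg ≥ λ_an`). -/
theorem mazurMainConjecture_etale_of_tangentPackage
    (hW16 : Wuthrich2014.charIdeal_dvd_padicLFunction)
    {W : WeierstrassCurve ℚ} [W.IsElliptic] [W.IsGloballyMinimal] {p : ℕ} [Fact p.Prime]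
    (hX1 : ClassX1 W p) (P : TangentPackage W p) : MazurMainConjecture P.Wet p := by
  have hX1' : ClassX1 P.Wet p := ClassX1.of_isIsogenous P.iso hX1
  have hp : p ≠ 2 := by have := hX1'.1; omega
  have hgo : GoodOrd P.Wet p := goodOrd_of_anom P.Wet p hX1'.2.2.2.1
  have hred : ¬ P.Wet.HasIrreducibleModPGaloisRep p := hX1'.2.1
  have hΞ : P.Ξ P.cl ≠ 0 :=
    an_ne_zero_of_alg_ne_zero P.kato P.katoMu P.helpers P.cl P.cl_mem P.alg_ne_zero
  obtain ⟨n, hn⟩ := exists_hasOrd_of_ne_zero hΞ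
  have hr : HasOrd (P.r P.cl) n := hasOrd_alg_of_hasOrd_an P.kato P.katoMu P.helpers n P.cl P.cl_mem hn
  exact Summit.BirchSwinnertonDyer.Rank1Residual.X1.TamagawaSqueeze.mazurMainConjecture_of_algebraicLambdaGE
    hW16 hp hgo.1 hgo.2 hred
    (Summit.BirchSwinnertonDyer.Rank1Residual.X1.MuPart.muPartAt_of_analyticMuLE_zero
      hW16 hp hgo.1 hgo.2 hred (P.an_mu hΞ))
    (P.an_lam n hn) (P.alg_lam n hr) le_rfl

/-! ## §3. The door: packages at every X1 rank-0 pair ⟹ the crux BY NAME -/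

/-- **K1 ∧ K2 ∧ K3 ∧ K4 (as tangent packages) + the published isogeny inputs ⟹ crux 5
`MazurMCOnX1RankZero`.** The named inputs are exactly those of the tree's isogeny door
`Rank1ResidualX1Isogeny.mazurMainConjecture_iff_of_isIsogenous_of_analyticRank_eq_zero`
(Wuthrich 2014 Thm. 16, Greenberg LNM 1716 Thm. 4.1, modularity, GZK, Cassels) — all PUBLISHED. -/
theorem mazurMCOnX1RankZero_of_tangentPackages
    (hW16 : Wuthrich2014.charIdeal_dvd_padicLFunction) (hGr : greenberg_charValue_rankZero)
    (hmod : nonempty_modularParametrizationData) (hmod' : hasEntireLFunction_rat)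
    (hGZK : rank_eq_analyticRank_of_analyticRank_le_one) (hCassels : bsdRHS_eq_of_isIsogenous)
    (hpkg : ∀ (W : WeierstrassCurve ℚ) [W.IsElliptic] [W.IsGloballyMinimal] (p : ℕ) [Fact p.Prime],
      ClassX1 W p → W.analyticRank = 0 → Nonempty (TangentPackage W p)) :
    Summit.BirchSwinnertonDyer.BirchSwinnertonDyer.Theses.EisensteinPrimes.MazurMCOnX1RankZero := by
  intro W _ _ p _ hX1 hr0
  obtain ⟨P⟩ := hpkg W p hX1 hr0
  have hMC : MazurMainConjecture P.Wet p := mazurMainConjecture_etale_of_tangentPackage hW16 hX1 P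
  exact (Summit.BirchSwinnertonDyer.BirchSwinnertonDyer.Theorems.Rank1ResidualX1Isogeny.mazurMainConjecture_iff_of_isIsogenous_of_analyticRank_eq_zero
    hW16 hGr hmod hmod' hGZK hCassels W P.Wet P.iso p hX1 hr0).mpr hMC

/-- **THE IDEA'S THESIS X (typed candidate, conjecture-grade): tangent packages exist at every X1 pair
of analytic rank 0** — i.e. K1 (analytic tangent functional, linear, étale periods) ∧ K2 (algebraic
tangent functional, linear, valuative) ∧ K3 (helper supply among Eisenstein-newform classes) ∧ K4
(`μ_alg(E_ét) = 0`) hold on the residual Selmer space of every type-A anomalous good Eisenstein class.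
Refutable: a single pencil of modular classes violating ultrametricity of `λ_an` (U3/U4 of the desk
census), or a class with `μ_alg(E_ét) ≥ 1`, kills it. [conjecture; idea g14] -/
def TangentPackagesExist : Prop :=
  ∀ (W : WeierstrassCurve ℚ) [W.IsElliptic] [W.IsGloballyMinimal] (p : ℕ) [Fact p.Prime],
    ClassX1 W p → W.analyticRank = 0 → Nonempty (TangentPackage W p)

/-- **X + published inputs ⟹ crux 5 by name.** -/
theorem mazurMCOnX1RankZero_of_tangentPackagesExist
    (hW16 : Wuthrich2014.charIdeal_dvd_padicLFunction) (hGr : greenberg_charValue_rankZero)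
    (hmod : nonempty_modularParametrizationData) (hmod' : hasEntireLFunction_rat)
    (hGZK : rank_eq_analyticRank_of_analyticRank_le_one) (hCassels : bsdRHS_eq_of_isIsogenous)
    (hX : TangentPackagesExist) :
    Summit.BirchSwinnertonDyer.BirchSwinnertonDyer.Theses.EisensteinPrimes.MazurMCOnX1RankZero :=
  mazurMCOnX1RankZero_of_tangentPackages hW16 hGr hmod hmod' hGZK hCassels
    (fun W _ _ p _ hX1 hr0 => hX W p hX1 hr0)

end Summit.BirchSwinnertonDyer.BirchSwinnertonDyer.Cruxes.MazurMCOnX1RankZero.PencilExchange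

end
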